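import Summits.AnomalousDissipation.AnomalousDissipation.Theorems.TwoAndHalfDTwohalfdNegFiniteModeTruncationPath
import Literature.Analysis.FunctionSpaces.TorusHolderBridge
import Literature.Analysis.FunctionSpaces.TorusFluidGlueProofs
import HarnessLib

/-!
# Low-mode paths of Leray–Hopf flows are uniformly Lipschitz on blocks of bounded energy

Stub FM-LIP (`stub_fmLowModeLipschitz`) of the finite-mode condensation corollary of the
regular-condensate theorem (crux `TwoAndHalfD.TwohalfdNeg`, stmt-AnomalousDissipation-0211, line
`log-kantorovich-enstrophy-transfer`, lead c7, wave 3).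

For a truncation level `K`, an energy level `R`, a viscosity ceiling `κ₀` and a steady smooth
force `g` on `T²` there is ONE constant `L'` such that for every global Leray–Hopf flow `v`
(viscosity `0 < κ ≤ κ₀`, force `g`) and every block `[a, a + S]`, `a > 0`, on which
`∫ ‖v(t)‖² ≤ R`, the block-clamped low-mode field
`W(t, x) = P_K v(a + c(t))(x)`, `c(t) = min (max t 0) S`, `P_K = Torus.fourierTruncate K`,
is `L'`-Lipschitz on `ℝ × T²` (sup metric), bounded by `L'`, and weakly divergence free at every
time.

* SPACE (`exists_lipschitzWith_fourierTruncate_of_energy_le`): `P_K u` is a real trigonometric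
  polynomial on the frequency ball `|k| ≤ K` whose coefficients are single Parseval terms,
  `‖û(k)‖ ≤ √R` (`TruncationPath.norm_mFourierCoeff_le_sqrt` of the landed stub FM-PATH), so
  `‖P_K u‖_∞ ≤ N√R` (`TruncationPath.norm_fourierTruncate_apply_le_card_mul_sqrt`, FM-PATH) and
  `‖∂ⱼ P_K u‖_∞ ≤ 2πK N √R`, `N = #freqBall K` (`Torus.norm_partialDeriv_realTrigPoly_le`); a
  gradient bound on `T^d` is a Lipschitz bound (`Torus.lipschitzWith_of_norm_partialDeriv_le`).
* TIME (`abs_integral_inner_sub_le_of_energy_le`, `norm_fourierTruncate_sub_le_of_frame_bounds`):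
  along the Galerkin frame `gᵢ = Torus.frameField k j c` (Robinson–Rodrigo–Sadowski 2016, §4.1)
  every slice of `v` at a positive time is weakly divergence free and
  `P_K v(s) = ∑ᵢ ⟪v(s), gᵢ⟫ gᵢ` over the full ball
  (`Torus.fourierTruncate_eq_sum_integral_inner_smul_frameField`); the time-sliced weak formulation
  (`Torus.IsLerayHopfOn.integral_inner_sub_eq_setIntegral`, Temam 1984, Ch. III (1.25)) gives
  `⟪v(s), gᵢ⟫ - ⟪v(s'), gᵢ⟫ = ∫_{(s',s]} Φ[v; gᵢ]` with the flux
  `Φ[v; Ψ](τ) = ∫ (⟪v, (v·∇)Ψ⟫ + κ⟪v, ΔΨ⟫ + ⟪g, Ψ⟫)(τ)` bounded on the block by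
  `‖∇Ψ‖_∞ R + κ₀ ‖ΔΨ‖_∞ ½(1 + R) + ‖Ψ‖_∞ ∫‖g‖` (`abs_nsFlux_le_of_energy_le`), whence each
  coefficient, and then `P_K v(·)(x)`, is Lipschitz in time on the block with a constant depending
  on `K, R, κ₀, g` only.
* The clamp `t ↦ a + c(t)` is `1`-Lipschitz into the block; `P_K` of a weakly divergence-free `L²`
  slice is divergence free (`Torus.isDivFree_fourierTruncate`), hence weakly so.

Supports stmt-AnomalousDissipation-0211. Sources: J. C. Robinson, J. L. Rodrigo, W. Sadowski,
*The three-dimensional Navier–Stokes equations*, CUP 2016, §4.1 [`RobinsonRodrigoSadowski2016`];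
R. Temam, *Navier–Stokes Equations* (1984), Ch. III §1.1 (1.25). Not here: continuity of the
unclamped path (stub FM-PATH), the block energy bound itself (stub FM-SUP), the selection (FM-SEL).
-/

noncomputable section

namespace Summit.AnomalousDissipation.AnomalousDissipation.Theorems.TwohalfdNeg.FiniteModeCondensate

open MeasureTheory Filter Topology
open scoped ENNReal NNReal InnerProductSpace
open Literature.Analysis.FunctionSpaces Literature.Analysis.FluidPDE

-- the summit and the problem are both `AnomalousDissipation` (path convention), hence the dup:
set_option linter.dupNamespace false

variable {d : Type*} [Fintype d] [DecidableEq d]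

/-! ## Space: sup and Lipschitz bounds of a truncation in terms of the energy -/

/-- **Gradient bound of a truncation by the energy**: `‖∂ⱼ P_K u(x)‖ ≤ 2πK N √R` if `∫ ‖u‖² ≤ R`
(`∂ⱼ` multiplies the coefficient `û(k)` by `2πi kⱼ`, `|kⱼ| ≤ |k| ≤ K` on the ball). [folklore] -/
theorem norm_partialDeriv_fourierTruncate_le_card_mul_sqrt {u : UnitAddTorus d → EuclideanSpace ℝ d}
    (hu : MemLp u 2 volume) {R : ℝ} (hR : ∫ x, ‖u x‖ ^ 2 ≤ R) (K : ℕ) (j : d) (x : UnitAddTorus d) :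
    ‖Torus.partialDeriv j (Torus.fourierTruncate K u) x‖ ≤
      2 * Real.pi * K * (Torus.freqBall (d := d) K).card * Real.sqrt R := by
  rw [Torus.fourierTruncate_eq]
  refine (Torus.norm_partialDeriv_realTrigPoly_le _ _ j x).trans ?_
  have hk : ∀ k ∈ Torus.freqBall K,
      2 * Real.pi * |(k j : ℝ)| * ‖UnitAddTorus.mFourierCoeff (EuclideanSpace.complexify ∘ u) k‖ ≤
        2 * Real.pi * K * Real.sqrt R := by
    intro k hk
    have h1 : |(k j : ℝ)| ≤ K := by
      refine (Torus.abs_apply_le_sqrt_freqNormSq k j).trans ?_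
      rw [← Real.sqrt_sq (Nat.cast_nonneg K)]
      exact Real.sqrt_le_sqrt (Torus.mem_freqBall.1 hk)
    have h2 := TruncationPath.norm_mFourierCoeff_le_sqrt hu hR k
    gcongr
  calc ∑ k ∈ Torus.freqBall K,
        2 * Real.pi * |(k j : ℝ)| * ‖UnitAddTorus.mFourierCoeff (EuclideanSpace.complexify ∘ u) k‖
      ≤ ∑ _k ∈ Torus.freqBall K, 2 * Real.pi * K * Real.sqrt R := Finset.sum_le_sum hk
    _ = 2 * Real.pi * K * (Torus.freqBall (d := d) K).card * Real.sqrt R := by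
        rw [Finset.sum_const, nsmul_eq_mul]; ring

/-- **Truncations of fields of energy `≤ R` are uniformly Lipschitz and bounded**: for fixed `K` and
`R` there is `L` with `P_K u` `L`-Lipschitz on `T^d` and `‖P_K u‖_∞ ≤ L` whenever `∫ ‖u‖² ≤ R`
(gradient bound `norm_partialDeriv_fourierTruncate_le_card_mul_sqrt` and
`Torus.lipschitzWith_of_norm_partialDeriv_le`; sup bound
`TruncationPath.norm_fourierTruncate_apply_le_card_mul_sqrt` of stub FM-PATH). [folklore] -/
theorem exists_lipschitzWith_fourierTruncate_of_energy_le (K : ℕ) (R : ℝ) :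
    ∃ L : ℝ≥0, ∀ u : UnitAddTorus d → EuclideanSpace ℝ d, MemLp u 2 volume → ∫ x, ‖u x‖ ^ 2 ≤ R →
      LipschitzWith L (Torus.fourierTruncate K u) ∧ ∀ x, ‖Torus.fourierTruncate K u x‖ ≤ L := by
  set M : ℝ≥0 := Real.toNNReal (2 * Real.pi * K * (Torus.freqBall (d := d) K).card * Real.sqrt R)
  set B : ℝ≥0 := Real.toNNReal ((Torus.freqBall (d := d) K).card * Real.sqrt R)
  have hMc : (M : ℝ) = 2 * Real.pi * K * (Torus.freqBall (d := d) K).card * Real.sqrt R :=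
    Real.coe_toNNReal _ (by positivity)
  refine ⟨NNReal.sqrt (Fintype.card d) * (∑ _j : d, M) + B, fun u hu huR => ⟨?_, fun x => ?_⟩⟩
  · refine (Torus.lipschitzWith_of_norm_partialDeriv_le (M := fun _ => M)
      ((Torus.isSmooth_fourierTruncate K u).isContDiff (by simp)) fun j x => ?_).weaken le_self_add
    rw [hMc]
    exact norm_partialDeriv_fourierTruncate_le_card_mul_sqrt hu huR K j x
  · calc ‖Torus.fourierTruncate K u x‖ ≤ (Torus.freqBall (d := d) K).card * Real.sqrt R :=
          TruncationPath.norm_fourierTruncate_apply_le_card_mul_sqrt hu huR K x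
      _ ≤ B := Real.le_coe_toNNReal _
      _ ≤ ((NNReal.sqrt (Fintype.card d) * (∑ _j : d, M) + B : ℝ≥0) : ℝ) := by
          exact_mod_cast le_add_self

/-! ## Time: the flux of the time-sliced weak formulation on a block of bounded energy -/

/-- **Flux bound.** For `U ∈ L²` with `∫ ‖U‖² ≤ R`, an integrable force slice `G`, a smooth test
field `Ψ` with `∑ᵢ ‖∂ᵢΨ‖ ≤ D`, `‖ΔΨ‖ ≤ K_L`, `‖Ψ‖ ≤ K_P`, and `|ν| ≤ ν₀`:
`|∫ (⟪U, (U·∇)Ψ⟫ + ν⟪U, ΔΨ⟫ + ⟪G, Ψ⟫)| ≤ D R + ν₀ K_L ½(1 + R) + K_P ∫ ‖G‖`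
(`|⟪U,(U·∇)Ψ⟫| ≤ D‖U‖²`, `∫‖U‖ ≤ ½(1 + ∫‖U‖²)`; the slicewise estimate behind
`Torus.IsLerayHopfOn.integrableOn_flux`). [folklore] -/
theorem abs_nsFlux_le_of_energy_le {U G Ψ : UnitAddTorus d → EuclideanSpace ℝ d}
    (hU : MemLp U 2 volume) (hG : Integrable G volume) (hΨ : Torus.IsSmooth Ψ)
    {ν ν₀ R D KL KP : ℝ} (hν : |ν| ≤ ν₀)
    (hR : ∫ x, ‖U x‖ ^ 2 ≤ R) (hD : ∀ x, ∑ i, ‖Torus.partialDeriv i Ψ x‖ ≤ D) (hKL0 : 0 ≤ KL)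
    (hKL : ∀ x, ‖Torus.laplacian Ψ x‖ ≤ KL) (hKP : ∀ x, ‖Ψ x‖ ≤ KP) :
    |∫ x, (⟪U x, Torus.convect U Ψ x⟫_ℝ + ν * ⟪U x, Torus.laplacian Ψ x⟫_ℝ + ⟪G x, Ψ x⟫_ℝ)| ≤
      D * R + ν₀ * KL * (2⁻¹ * (1 + R)) + KP * ∫ x, ‖G x‖ := by
  have hD0 : 0 ≤ D := (Finset.sum_nonneg fun i _ => norm_nonneg _).trans (hD 0)
  have i1 := Torus.integrable_inner_convect_self hU hΨ
  have i2 : Integrable (fun x => ⟪U x, Torus.laplacian Ψ x⟫_ℝ) volume :=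
    Torus.integrable_inner_of_continuous (hU.integrable one_le_two) hΨ.laplacian.continuous
  have i3 : Integrable (fun x => ⟪G x, Ψ x⟫_ℝ) volume :=
    Torus.integrable_inner_of_continuous hG hΨ.continuous
  have i12 : Integrable (fun x => ⟪U x, Torus.convect U Ψ x⟫_ℝ + ν * ⟪U x, Torus.laplacian Ψ x⟫_ℝ)
      volume := i1.add (i2.const_mul ν)
  rw [integral_add i12 i3, integral_add i1 (i2.const_mul ν), integral_const_mul]
  have b1 : |∫ x, ⟪U x, Torus.convect U Ψ x⟫_ℝ| ≤ D * R :=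
    (Torus.abs_integral_inner_convect_self_le hU hΨ hD).trans (mul_le_mul_of_nonneg_left hR hD0)
  have b2 : |ν * ∫ x, ⟪U x, Torus.laplacian Ψ x⟫_ℝ| ≤ ν₀ * KL * (2⁻¹ * (1 + R)) := by
    rw [abs_mul, mul_assoc]
    refine mul_le_mul hν ?_ (abs_nonneg _) ((abs_nonneg ν).trans hν)
    refine (Torus.abs_integral_inner_le_of_norm_le (hU.integrable one_le_two) hKL).trans ?_
    refine mul_le_mul_of_nonneg_left ((Torus.integral_norm_le_of_memLp_two hU).trans ?_) hKL0
    gcongr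
  have b3 : |∫ x, ⟪G x, Ψ x⟫_ℝ| ≤ KP * ∫ x, ‖G x‖ := Torus.abs_integral_inner_le_of_norm_le hG hKP
  calc _ ≤ |∫ x, ⟪U x, Torus.convect U Ψ x⟫_ℝ| + |ν * ∫ x, ⟪U x, Torus.laplacian Ψ x⟫_ℝ| +
        |∫ x, ⟪G x, Ψ x⟫_ℝ| := abs_add_three _ _ _
    _ ≤ _ := by linarith

/-- **Tested pairings of a Leray–Hopf flow are Lipschitz in time on a block of bounded energy.**
For a global Leray–Hopf flow `v` on `T^d` with steady smooth force `g` and viscosity `|κ| ≤ κ₀`,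
a smooth divergence-free `Ψ` with `∑ᵢ ‖∂ᵢΨ‖ ≤ D`, `‖ΔΨ‖ ≤ K_L`, `‖Ψ‖ ≤ K_P`, and a block
`[a, b]`, `a > 0`, on which `∫ ‖v(t)‖² ≤ R`: for `s, s' ∈ [a, b]`,
`|⟪v(s), Ψ⟫ - ⟪v(s'), Ψ⟫| ≤ |s - s'| (D R + κ₀ K_L ½(1 + R) + K_P ∫‖g‖)` — the time-sliced weak
formulation `⟪v(s), Ψ⟫ - ⟪v(s'), Ψ⟫ = ∫_{(s',s]} Φ[v; Ψ]` (Temam 1984, Ch. III (1.25),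
`Torus.IsLerayHopfOn.integral_inner_sub_eq_setIntegral`) and the flux bound
`abs_nsFlux_le_of_energy_le` at EVERY time of the block.
[cite: RobinsonRodrigoSadowski2016, §4.1] -/
theorem abs_integral_inner_sub_le_of_energy_le {κ κ₀ : ℝ}
    {g v₀ Ψ : UnitAddTorus d → EuclideanSpace ℝ d} {v : ℝ → UnitAddTorus d → EuclideanSpace ℝ d}
    (hv : Torus.IsGlobalLerayHopf κ (fun _ => g) v₀ v) (hg : Torus.IsSmooth g) (hκ : |κ| ≤ κ₀)
    (hΨ : Torus.IsSmooth Ψ) (hΨdiv : Torus.IsDivFree Ψ)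
    {a b R D KL KP : ℝ} (ha : 0 < a) (hR : ∀ t ∈ Set.Icc a b, ∫ x, ‖v t x‖ ^ 2 ≤ R)
    (hD : ∀ x, ∑ i, ‖Torus.partialDeriv i Ψ x‖ ≤ D) (hKL0 : 0 ≤ KL)
    (hKL : ∀ x, ‖Torus.laplacian Ψ x‖ ≤ KL) (hKP : ∀ x, ‖Ψ x‖ ≤ KP) {s s' : ℝ}
    (hs : s ∈ Set.Icc a b) (hs' : s' ∈ Set.Icc a b) :
    |(∫ x, ⟪v s x, Ψ x⟫_ℝ) - ∫ x, ⟪v s' x, Ψ x⟫_ℝ| ≤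
      |s - s'| * (D * R + κ₀ * KL * (2⁻¹ * (1 + R)) + KP * ∫ x, ‖g x‖) := by
  wlog hle : s' ≤ s generalizing s s' with H
  · have h := H hs' hs (le_of_not_ge hle)
    rwa [abs_sub_comm, abs_sub_comm s' s] at h
  have hb : 0 < b := ha.trans_le (hs.1.trans hs.2)
  -- the steady force: measurability and finite space–time mass on `(0, b) × T^d`
  have hfm : AEStronglyMeasurable (Torus.stLift fun _ : ℝ => g)
      (volume.restrict (Set.Ioo 0 b ×ˢ Set.univ)) :=
    (hg.continuous.comp (Torus.continuous_proj.comp continuous_snd)).aestronglyMeasurable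
  have hf2 : ∫⁻ _ in Set.Ioo (0 : ℝ) b, ∫⁻ x, ‖g x‖ₑ ^ 2 < ∞ := by
    rw [setLIntegral_const, Torus.lintegral_enorm_sq_eq_ofReal (hg.memLp 2)]
    exact ENNReal.mul_lt_top ENNReal.ofReal_lt_top measure_Ioo_lt_top
  rw [(hv b hb).integral_inner_sub_eq_setIntegral hb hfm hf2 hΨ hΨdiv (ha.trans_le hs'.1) hle hs.2,
    abs_of_nonneg (sub_nonneg.2 hle), ← Real.norm_eq_abs]
  have hbound : ∀ τ ∈ Set.Ioc s' s, ‖∫ x, (⟪v τ x, Torus.convect (v τ) Ψ x⟫_ℝ +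
      κ * ⟪v τ x, Torus.laplacian Ψ x⟫_ℝ + ⟪g x, Ψ x⟫_ℝ)‖ ≤
        D * R + κ₀ * KL * (2⁻¹ * (1 + R)) + KP * ∫ x, ‖g x‖ := by
    intro τ hτ
    have hτI : τ ∈ Set.Icc a b := ⟨hs'.1.trans hτ.1.le, hτ.2.trans hs.2⟩
    rw [Real.norm_eq_abs]
    exact abs_nsFlux_le_of_energy_le (hv.memLp_two (ha.le.trans hτI.1)) hg.integrable hΨ hκ
      (hR τ hτI) hD hKL0 hKL hKP
  refine (norm_setIntegral_le_of_norm_le_const measure_Ioc_lt_top hbound).trans_eq ?_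
  rw [Real.volume_real_Ioc_of_le hle, mul_comm]

/-- **Low-mode paths are Lipschitz in time, pointwise in space.** Along the Galerkin frame
`gᵢ = Torus.frameField k j c` over the full ball `|k| ≤ K` (Robinson–Rodrigo–Sadowski 2016, §4.1),
`P_K v(s)(x) - P_K v(s')(x) = ∑ᵢ (⟪v(s), gᵢ⟫ - ⟪v(s'), gᵢ⟫) gᵢ(x)` for the (weakly
divergence-free, `L²`) slices of a global Leray–Hopf flow at positive times
(`Torus.fourierTruncate_eq_sum_integral_inner_smul_frameField`); so per-mode time bounds
`|⟪v(s), gᵢ⟫ - ⟪v(s'), gᵢ⟫| ≤ |s - s'| Mᵢ` and sup bounds `‖gᵢ‖ ≤ K_Pᵢ` give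
`‖P_K v(s)(x) - P_K v(s')(x)‖ ≤ |s - s'| ∑ᵢ Mᵢ K_Pᵢ`. [cite: RobinsonRodrigoSadowski2016, §4.1] -/
theorem norm_fourierTruncate_sub_le_of_frame_bounds {κ : ℝ}
    {g v₀ : UnitAddTorus d → EuclideanSpace ℝ d} {v : ℝ → UnitAddTorus d → EuclideanSpace ℝ d}
    (hv : Torus.IsGlobalLerayHopf κ (fun _ => g) v₀ v) {a b : ℝ} (ha : 0 < a)
    {M KP : (d → ℤ) × d × Bool → ℝ} (hM0 : ∀ i, 0 ≤ M i)
    (hM : ∀ i, ∀ s ∈ Set.Icc a b, ∀ s' ∈ Set.Icc a b,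
      |(∫ x, ⟪v s x, Torus.frameField i.1 i.2.1 i.2.2 x⟫_ℝ) -
        ∫ x, ⟪v s' x, Torus.frameField i.1 i.2.1 i.2.2 x⟫_ℝ| ≤ |s - s'| * M i)
    (hKP : ∀ i x, ‖Torus.frameField i.1 i.2.1 i.2.2 x‖ ≤ KP i) (K : ℕ) {s s' : ℝ}
    (hs : s ∈ Set.Icc a b) (hs' : s' ∈ Set.Icc a b) (x : UnitAddTorus d) :
    ‖Torus.fourierTruncate K (v s) x - Torus.fourierTruncate K (v s') x‖ ≤
      |s - s'| *
        ∑ i ∈ Torus.freqBall K ×ˢ ((Finset.univ : Finset d) ×ˢ (Finset.univ : Finset Bool)),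
          M i * KP i := by
  have hb : 0 < b := ha.trans_le (hs.1.trans hs.2)
  have hmem : ∀ t ∈ Set.Icc a b, MemLp (v t) 2 volume := fun t ht => hv.memLp_two (ha.le.trans ht.1)
  have hdiv : ∀ t ∈ Set.Icc a b, Torus.IsWeaklyDivFree (v t) := fun t ht =>
    (hv b hb).isWeaklyDivFree_of_mem_Ioc ⟨ha.trans_le ht.1, ht.2⟩
  rw [Torus.fourierTruncate_eq_sum_integral_inner_smul_frameField (hmem s hs) (hdiv s hs) K,
    Torus.fourierTruncate_eq_sum_integral_inner_smul_frameField (hmem s' hs') (hdiv s' hs') K]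
  dsimp only
  rw [← Finset.sum_sub_distrib, Finset.mul_sum]
  refine (norm_sum_le _ _).trans (Finset.sum_le_sum fun i _ => ?_)
  rw [← sub_smul, norm_smul, Real.norm_eq_abs, ← mul_assoc]
  exact mul_le_mul (hM i s hs s' hs') (hKP i x) (norm_nonneg _) (mul_nonneg (abs_nonneg _) (hM0 i))

/-! ## The registered stub -/

/-- **FM-LIP `stub_fmLowModeLipschitz` (registered stub, verbatim).** For fixed `K`, `R ≥ 0`,
`κ₀ > 0` and a smooth steady force `g` on `T²` there is ONE `L' : ℝ≥0` such that for every level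
(`0 < κ ≤ κ₀`, any global Leray–Hopf flow `v` forced by `g`) and every block `[a, a + S]`, `a > 0`,
on which `∫ ‖v(t)‖² ≤ R`, the block-clamped low-mode field
`(t, x) ↦ P_K v(a + min (max t 0) S)(x)` is `L'`-Lipschitz on `ℝ × T²`, bounded by `L'`, and weakly
divergence free at every time. `L' = L_space + ∑ᵢ Mᵢ‖gᵢ‖_∞` with `L_space` from
`exists_lipschitzWith_fourierTruncate_of_energy_le` and the per-mode time constants
`Mᵢ = ‖∇gᵢ‖ R + κ₀‖Δgᵢ‖_∞ ½(1+R) + ‖gᵢ‖_∞ ∫‖g‖` of `abs_integral_inner_sub_le_of_energy_le`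
along the Galerkin frame (Robinson–Rodrigo–Sadowski 2016, §4.1); the clamp is `1`-Lipschitz into
the block; divergence by `Torus.isDivFree_fourierTruncate`.
[cite: RobinsonRodrigoSadowski2016, §4.1] -/
theorem stub_fmLowModeLipschitz :
    ∀ (K : ℕ) (R κ₀ : ℝ) (g : UnitAddTorus (Fin 2) → EuclideanSpace ℝ (Fin 2)), 0 ≤ R → 0 < κ₀ → Torus.IsSmooth g →
      ∃ L' : ℝ≥0, ∀ (κ a S : ℝ) (v₀ : UnitAddTorus (Fin 2) → EuclideanSpace ℝ (Fin 2))
        (v : ℝ → UnitAddTorus (Fin 2) → EuclideanSpace ℝ (Fin 2)),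
        0 < κ → κ ≤ κ₀ → 0 < a → 0 < S → Torus.IsGlobalLerayHopf κ (fun _ => g) v₀ v →
        (∀ t ∈ Set.Icc a (a + S), ∫ x, ‖v t x‖ ^ 2 ≤ R) →
        LipschitzWith L' (Function.uncurry fun t x => Torus.fourierTruncate K (v (a + min (max t 0) S)) x) ∧
          (∀ t x, ‖Torus.fourierTruncate K (v (a + min (max t 0) S)) x‖ ≤ L') ∧
          (∀ t, Torus.IsWeaklyDivFree (Torus.fourierTruncate K (v (a + min (max t 0) S)))) := by
  intro K R κ₀ g hR hκ₀ hg
  -- space constants (depend on `K`, `R`)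
  obtain ⟨Lx, hLx⟩ := exists_lipschitzWith_fourierTruncate_of_energy_le (d := Fin 2) K R
  -- frame constants (depend on `K` only) and the time constant
  choose D hD0 hD using fun i : (Fin 2 → ℤ) × Fin 2 × Bool =>
    Torus.exists_sum_norm_partialDeriv_le (Torus.isSmooth_frameField i.1 i.2.1 i.2.2)
  choose KL hKL0 hKL using fun i : (Fin 2 → ℤ) × Fin 2 × Bool =>
    Torus.exists_nonneg_forall_norm_le_of_continuous
      (Torus.isSmooth_frameField i.1 i.2.1 i.2.2).laplacian.continuous
  choose KP hKP0 hKP using fun i : (Fin 2 → ℤ) × Fin 2 × Bool =>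
    Torus.exists_nonneg_forall_norm_le_of_continuous (Torus.continuous_frameField i.1 i.2.1 i.2.2)
  have hg0 : 0 ≤ ∫ y, ‖g y‖ := integral_nonneg fun _ => norm_nonneg _
  set M : (Fin 2 → ℤ) × Fin 2 × Bool → ℝ := fun i =>
    D i * R + κ₀ * KL i * (2⁻¹ * (1 + R)) + KP i * ∫ y, ‖g y‖
  have hM0 : ∀ i, 0 ≤ M i := fun i => by
    have := hD0 i; have := hKL0 i; have := hKP0 i
    positivity
  set Lt : ℝ :=
    ∑ i ∈ Torus.freqBall K ×ˢ ((Finset.univ : Finset (Fin 2)) ×ˢ (Finset.univ : Finset Bool)),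
      M i * KP i
  have hLt0 : 0 ≤ Lt := Finset.sum_nonneg fun i _ => mul_nonneg (hM0 i) (hKP0 i)
  have hL' : ((Lx + Real.toNNReal Lt : ℝ≥0) : ℝ) = Lx + Lt := by
    rw [NNReal.coe_add, Real.coe_toNNReal _ hLt0]
  refine ⟨Lx + Real.toNNReal Lt, fun κ a S v₀ v hκ hκle ha hS hv hRv => ?_⟩
  have hκ' : |κ| ≤ κ₀ := by rwa [abs_of_pos hκ]
  -- the clamp lands in the block
  have hcI : ∀ t : ℝ, a + min (max t 0) S ∈ Set.Icc a (a + S) := fun t =>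
    ⟨le_add_of_nonneg_right (le_min (le_max_right t 0) hS.le), add_le_add le_rfl (min_le_right _ _)⟩
  have hclamp : ∀ t t' : ℝ, |min (max t 0) S - min (max t' 0) S| ≤ |t - t'| := fun t t' =>
    calc |min (max t 0) S - min (max t' 0) S| ≤ max |max t 0 - max t' 0| |S - S| :=
          abs_min_sub_min_le_max _ _ _ _
      _ ≤ |t - t'| := by
          rw [sub_self, abs_zero]
          exact max_le (abs_max_sub_max_le_abs _ _ _) (abs_nonneg _)
  have hmem : ∀ t : ℝ, MemLp (v (a + min (max t 0) S)) 2 volume := fun t =>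
    hv.memLp_two (ha.le.trans (hcI t).1)
  have hdiv : ∀ t : ℝ, Torus.IsWeaklyDivFree (v (a + min (max t 0) S)) := fun t =>
    (hv (a + S) (by linarith)).isWeaklyDivFree_of_mem_Ioc ⟨ha.trans_le (hcI t).1, (hcI t).2⟩
  -- per-mode time bounds on the block
  have hMt : ∀ i, ∀ s ∈ Set.Icc a (a + S), ∀ s' ∈ Set.Icc a (a + S),
      |(∫ x, ⟪v s x, Torus.frameField i.1 i.2.1 i.2.2 x⟫_ℝ) -
        ∫ x, ⟪v s' x, Torus.frameField i.1 i.2.1 i.2.2 x⟫_ℝ| ≤ |s - s'| * M i :=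
    fun i s hs s' hs' => abs_integral_inner_sub_le_of_energy_le hv hg hκ'
      (Torus.isSmooth_frameField _ _ _) (Torus.isDivFree_frameField' _ _ _) ha hRv (hD i) (hKL0 i)
      (hKL i) (hKP i) hs hs'
  refine ⟨LipschitzWith.of_dist_le_mul ?_, fun t x => ?_, fun t => ?_⟩
  · rintro ⟨t, x⟩ ⟨t', x'⟩
    simp only [Function.uncurry_apply_pair]
    have ht : dist t t' ≤ dist (t, x) (t', x') := by rw [Prod.dist_eq]; exact le_max_left _ _
    have hx : dist x x' ≤ dist (t, x) (t', x') := by rw [Prod.dist_eq]; exact le_max_right _ _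
    have h1 : dist (Torus.fourierTruncate K (v (a + min (max t 0) S)) x)
        (Torus.fourierTruncate K (v (a + min (max t' 0) S)) x) ≤ Lt * dist t t' := by
      rw [dist_eq_norm, Real.dist_eq]
      refine (norm_fourierTruncate_sub_le_of_frame_bounds hv ha hM0 hMt hKP K (hcI t) (hcI t')
        x).trans ?_
      rw [mul_comm, add_sub_add_left_eq_sub]
      exact mul_le_mul_of_nonneg_left (hclamp t t') hLt0
    have h2 : dist (Torus.fourierTruncate K (v (a + min (max t' 0) S)) x)
        (Torus.fourierTruncate K (v (a + min (max t' 0) S)) x') ≤ Lx * dist x x' :=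
      (hLx _ (hmem t') (hRv _ (hcI t'))).1.dist_le_mul x x'
    calc dist (Torus.fourierTruncate K (v (a + min (max t 0) S)) x)
          (Torus.fourierTruncate K (v (a + min (max t' 0) S)) x')
        ≤ dist (Torus.fourierTruncate K (v (a + min (max t 0) S)) x)
            (Torus.fourierTruncate K (v (a + min (max t' 0) S)) x) +
          dist (Torus.fourierTruncate K (v (a + min (max t' 0) S)) x)
            (Torus.fourierTruncate K (v (a + min (max t' 0) S)) x') := dist_triangle _ _ _
      _ ≤ Lt * dist t t' + Lx * dist x x' := add_le_add h1 h2
      _ ≤ Lt * dist (t, x) (t', x') + Lx * dist (t, x) (t', x') := by gcongr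
      _ = ((Lx + Real.toNNReal Lt : ℝ≥0) : ℝ) * dist (t, x) (t', x') := by rw [hL']; ring
  · refine ((hLx _ (hmem t) (hRv _ (hcI t))).2 x).trans ?_
    rw [hL']
    exact le_add_of_nonneg_right hLt0
  · exact (Torus.isDivFree_fourierTruncate (hmem t) (hdiv t) K).isWeaklyDivFree_holds
      (Torus.isSmooth_fourierTruncate K _)

end Summit.AnomalousDissipation.AnomalousDissipation.Theorems.TwohalfdNeg.FiniteModeCondensate

end
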